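import Summits.CriticalPhenomena.PercolationContinuityZ3.Theorems.PercNearOneGluingNoHeavyLowerTailAntipodalStrongHarrisGraded
import Literature.Probability.LatticeModels.RandomClusterFKG
import HarnessLib

/-!
# Graded antipodal Aas–Gladkov sums on multigraphs: monotonicity under a terminal–terminal edge

Helper file for crux `stmt-CriticalPhenomena-4575` (`NoHeavyLowerTail`), unit `prim-gen-kcluster` gen 84
(memo `prim-gen-kcluster/KCLUSTER-gen84.md` §0.1 (c), §6).  No definitions, no named facts, no sorries.

This is the graph dictionary for the cube-level recursion `AntipodalStrongHarris.gradedSum_le_gradedSum_insert_of_terminalEdge`.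
A finite multigraph is an edge system `ends : ι → Sym2 V`; for a set `Y` of edge labels its graph is
`fromEdgeSet {s | ∃ i ∈ Y, ends i = s}`, its rank `ρ Y` is the number of connected components of that graph, and for three
terminals `t₀, t₁, t₂` its Aas–Gladkov label `f Y ∈ Lab 3` records the reachability pattern of the terminals (`top`: all
joined; `petal p`: `t_p` apart and the other two joined; `bot`: pairwise apart).  `ρ` and `f` are taken as variables
characterised by hypotheses (`hρ`, `hf`), so that no definition is introduced.

**Theorem** (`gradedAG_le_of_terminalEdge`).  If `a ∉ S` is an edge label with `ends a = s(t₀, t₁)`, `t₀ ≠ t₁` (a new edge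
joining two terminals), then for every level `ℓ`
`Σ_{X ⊆ S, ρ X + ρ(S∖X) = ℓ} κ(f X, f(S∖X)) ≤ Σ_{X ⊆ S ∪ {a}, ρ X + ρ((S∪{a})∖X) = ℓ} κ(f X, f((S∪{a})∖X))`,
i.e. the level-`ℓ` antipodal Aas–Gladkov sum `AG_ℓ` of the memos is monotone under adding a terminal–terminal edge
(`AG_ℓ(G ∖ t_it_j) ≤ AG_ℓ(G)`): for the graded Aas–Gladkov conjecture F4_s one may assume no terminal–terminal edges.
Proof: verify the hypothesis of the cube lemma — adding the edge `t₀t₁` to the graph of `Y` leaves the component count and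
all reachabilities unchanged when `t₀, t₁` are already joined (`Literature…card_connectedComponent_sup_edge_of_reachable`,
`…reachable_sup_edge_imp`), and otherwise lowers the count by exactly one (`…_sup_edge_lt`, `…_le_sup_edge_add_one`) while
moving the label `bot ↦ petal 2`, `petal 0, petal 1 ↦ top`.  [this work]
-/

namespace Summit.CriticalPhenomena.PercolationContinuityZ3.Theorems

namespace AntipodalStrongHarris

open Lab Finset SimpleGraph
open Literature.Probability.LatticeModels (reachable_sup_edge_imp card_connectedComponent_sup_edge_of_reachable
  card_connectedComponent_sup_edge_lt card_connectedComponent_le_sup_edge_add_one)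

variable {V : Type*} {ι : Type*} [DecidableEq ι]

/-- The graph of `insert a Y` is the graph of `Y` with the edge `ends a = s(u, v)` added. [this work] -/
theorem graphOf_insert_eq_sup_edge (ends : ι → Sym2 V) {a : ι} {u v : V} (hends : ends a = s(u, v))
    (Y : Finset ι) :
    fromEdgeSet {s : Sym2 V | ∃ i ∈ insert a Y, ends i = s} =
      fromEdgeSet {s : Sym2 V | ∃ i ∈ Y, ends i = s} ⊔ edge u v := by
  rw [edge, ← fromEdgeSet_union]
  congr 1
  ext s
  simp only [Set.mem_setOf_eq, Finset.mem_insert, Set.mem_union, Set.mem_singleton_iff]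
  constructor
  · rintro ⟨i, rfl | hi, he⟩
    · exact Or.inr (he ▸ hends.symm ▸ rfl)
    · exact Or.inl ⟨i, hi, he⟩
  · rintro (⟨i, hi, he⟩ | rfl)
    · exact ⟨i, Or.inr hi, he⟩
    · exact ⟨a, Or.inl rfl, hends⟩

/-- Adding an edge between two already joined vertices does not change reachability. [this work] -/
theorem reachable_sup_edge_iff_of_reachable (H : SimpleGraph V) {u v : V} (huv : H.Reachable u v) (x y : V) :
    (H ⊔ edge u v).Reachable x y ↔ H.Reachable x y := by
  constructor
  · intro h
    rcases reachable_sup_edge_imp H u v h with h | ⟨h1, h2⟩ | ⟨h1, h2⟩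
    · exact h
    · exact h1.trans (huv.trans h2)
    · exact h1.trans (huv.symm.trans h2)
  · exact fun h => h.mono le_sup_left

/-- After adding the edge `uv` (`u ≠ v`), `u` and `v` are joined. [this work] -/
theorem reachable_sup_edge_self (H : SimpleGraph V) {u v : V} (huv : u ≠ v) : (H ⊔ edge u v).Reachable u v :=
  Adj.reachable ((sup_adj _ _ _ _).2 (Or.inr ((edge_adj _ _ _ _).2 ⟨Or.inl ⟨rfl, rfl⟩, huv⟩)))

/-- After adding the edge `uv`, a vertex `w` is joined to `u` iff it was joined to `u` or to `v`. [this work] -/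
theorem reachable_sup_edge_left_iff (H : SimpleGraph V) {u v : V} (huv : u ≠ v) (w : V) :
    (H ⊔ edge u v).Reachable u w ↔ H.Reachable u w ∨ H.Reachable v w := by
  constructor
  · intro h
    rcases reachable_sup_edge_imp H u v h with h | ⟨_, h2⟩ | ⟨h1, h2⟩
    · exact Or.inl h
    · exact Or.inr h2
    · exact Or.inl h2
  · rintro (h | h)
    · exact h.mono le_sup_left
    · exact (reachable_sup_edge_self H huv).trans (h.mono le_sup_left)

/-- **Graded antipodal Aas–Gladkov sums are monotone under adding a terminal–terminal edge.**  See the module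
docstring; `ρ` = number of connected components, `f` = terminal reachability pattern, both characterised by the
hypotheses `hρ`, `hf`. [this work] -/
theorem gradedAG_le_of_terminalEdge [Finite V] (ends : ι → Sym2 V) (t₀ t₁ t₂ : V) (h01 : t₀ ≠ t₁)
    {S : Finset ι} {a : ι} (ha : a ∉ S) (hends : ends a = s(t₀, t₁))
    (ρ : Finset ι → ℕ)
    (hρ : ∀ Y, ρ Y = Nat.card (fromEdgeSet {s : Sym2 V | ∃ i ∈ Y, ends i = s}).ConnectedComponent)
    (f : Finset ι → Lab 3)
    (hf_top : ∀ Y, f Y = top ↔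
      ((fromEdgeSet {s : Sym2 V | ∃ i ∈ Y, ends i = s}).Reachable t₀ t₁ ∧
        (fromEdgeSet {s : Sym2 V | ∃ i ∈ Y, ends i = s}).Reachable t₀ t₂))
    (hf_two : ∀ Y, f Y = petal 2 ↔
      ((fromEdgeSet {s : Sym2 V | ∃ i ∈ Y, ends i = s}).Reachable t₀ t₁ ∧
        ¬ (fromEdgeSet {s : Sym2 V | ∃ i ∈ Y, ends i = s}).Reachable t₀ t₂))
    (hf_one : ∀ Y, f Y = petal 1 ↔
      (¬ (fromEdgeSet {s : Sym2 V | ∃ i ∈ Y, ends i = s}).Reachable t₀ t₁ ∧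
        (fromEdgeSet {s : Sym2 V | ∃ i ∈ Y, ends i = s}).Reachable t₀ t₂))
    (hf_zero : ∀ Y, f Y = petal 0 ↔
      (¬ (fromEdgeSet {s : Sym2 V | ∃ i ∈ Y, ends i = s}).Reachable t₀ t₁ ∧
        ¬ (fromEdgeSet {s : Sym2 V | ∃ i ∈ Y, ends i = s}).Reachable t₀ t₂ ∧
        (fromEdgeSet {s : Sym2 V | ∃ i ∈ Y, ends i = s}).Reachable t₁ t₂))
    (hf_bot : ∀ Y, f Y = bot ↔
      (¬ (fromEdgeSet {s : Sym2 V | ∃ i ∈ Y, ends i = s}).Reachable t₀ t₁ ∧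
        ¬ (fromEdgeSet {s : Sym2 V | ∃ i ∈ Y, ends i = s}).Reachable t₀ t₂ ∧
        ¬ (fromEdgeSet {s : Sym2 V | ∃ i ∈ Y, ends i = s}).Reachable t₁ t₂))
    (ℓ : ℕ) :
    (∑ X ∈ S.powerset, if ρ X + ρ (S \ X) = ℓ then kappa (f X) (f (S \ X)) else 0) ≤
      ∑ X ∈ (insert a S).powerset,
        if ρ X + ρ (insert a S \ X) = ℓ then kappa (f X) (f (insert a S \ X)) else 0 := by
  refine gradedSum_le_gradedSum_insert_of_terminalEdge ha f ρ 2 (fun Y _ => ?_) ℓ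
  -- the graphs of `Y` and of `insert a Y`
  set H := fromEdgeSet {s : Sym2 V | ∃ i ∈ Y, ends i = s} with hH
  have hH' : fromEdgeSet {s : Sym2 V | ∃ i ∈ insert a Y, ends i = s} = H ⊔ edge t₀ t₁ :=
    graphOf_insert_eq_sup_edge ends hends Y
  have e01 : (H ⊔ edge t₀ t₁).Reachable t₀ t₁ := reachable_sup_edge_self H h01
  by_cases hr : H.Reachable t₀ t₁
  · -- the edge is spanned: nothing changes, and `f Y ∈ {petal 2, top}`
    left
    have hiff := reachable_sup_edge_iff_of_reachable H hr
    refine ⟨?_, ?_, ?_⟩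
    · rw [hρ, hρ, hH', card_connectedComponent_sup_edge_of_reachable H hr]
    · by_cases h2 : H.Reachable t₀ t₂
      · have hY : f Y = top := (hf_top Y).2 ⟨hr, h2⟩
        have hY' : f (insert a Y) = top := (hf_top _).2 (by rw [hH', hiff, hiff]; exact ⟨hr, h2⟩)
        rw [hY, hY']
      · have hY : f Y = petal 2 := (hf_two Y).2 ⟨hr, h2⟩
        have hY' : f (insert a Y) = petal 2 := (hf_two _).2 (by rw [hH', hiff, hiff]; exact ⟨hr, h2⟩)
        rw [hY, hY']
    · by_cases h2 : H.Reachable t₀ t₂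
      · exact Or.inr ((hf_top Y).2 ⟨hr, h2⟩)
      · exact Or.inl ((hf_two Y).2 ⟨hr, h2⟩)
  · -- the edge joins two components: the count drops by one and the label moves
    right
    refine ⟨?_, ?_⟩
    · rw [hρ, hρ, hH', ← hH]
      have h1 := card_connectedComponent_sup_edge_lt H hr
      have h2 := card_connectedComponent_le_sup_edge_add_one H t₀ t₁
      omega
    · have h02' : (H ⊔ edge t₀ t₁).Reachable t₀ t₂ ↔ H.Reachable t₀ t₂ ∨ H.Reachable t₁ t₂ :=
        reachable_sup_edge_left_iff H h01 t₂
      by_cases h2 : H.Reachable t₀ t₂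
      · -- `petal 1 ↦ top`
        refine Or.inr ⟨1, by decide, (hf_one Y).2 ⟨hr, h2⟩, (hf_top _).2 ?_⟩
        rw [hH']
        exact ⟨e01, h02'.2 (Or.inl h2)⟩
      · by_cases h12 : H.Reachable t₁ t₂
        · -- `petal 0 ↦ top`
          refine Or.inr ⟨0, by decide, (hf_zero Y).2 ⟨hr, h2, h12⟩, (hf_top _).2 ?_⟩
          rw [hH']
          exact ⟨e01, h02'.2 (Or.inr h12)⟩
        · -- `bot ↦ petal 2`
          refine Or.inl ⟨(hf_bot Y).2 ⟨hr, h2, h12⟩, (hf_two _).2 ?_⟩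
          rw [hH']
          exact ⟨e01, fun h => (h02'.1 h).elim h2 h12⟩

end AntipodalStrongHarris

end Summit.CriticalPhenomena.PercolationContinuityZ3.Theorems
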